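import Mathlib
import Summits.Ventures.PercRepro2.HCov
import Summits.Ventures.PercRepro2.HCovSwap

/-!
# THEOREM (TYPE-RB): BHK 1.3 / 1.4 survive conditioning on the SIDE of a third vertex (blind cell
PercRepro2, typer-1; mine-a g3 MINE-A.md §19, INBOX 2026-08-23T14:21:55Z "Lean-sized: four landed
lemmas + a 3-point algebra")

Under `Q = {a₁ ↮ a₂}` the third vertex `a₃` has a side `τ ∈ {L, H, N}`: `L = T′ = {a₃ ∈ C(a₁)}`
(`TEvent ends a₂ a₁ a₃`), `H = T = {a₃ ∈ C(a₂)}` (`TEvent ends a₁ a₂ a₃`), `N = PD` (`PDEvent`);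
`Q = L ⊔ H ⊔ N`. With `bL = {b ∈ C(a₁)}`, `oH = {o ∈ C(a₂)}`, `oL = {o ∈ C(a₁)}`:

* **`typeRB_cross`** (cleared by `P(L) P(H) P(N) P(Q)`):
  `P(Q) Σ_τ P(τ, bL) P(τ, oH) Π_{τ' ≠ τ} P(τ') ≤ P(Q, bL) P(Q, oH) P(L) P(H) P(N)`
  — `Σ_τ μ(τ) μ(bL | τ) μ(oH | τ) ≤ μ(bL) μ(oH)`, i.e. `Cov_μ(1_{bL}, μ(oH | σ₃)) ≤ 0`;
* **`typeRB_same`**: the same with `oH` replaced by `oL` and `≤` by `≥`.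

Proof (mine-a's certificate). `LHS − RHS = (W_L − W_N) c_L + (W_H − W_N) c_H` with
`c_τ = P(Q) P(τ, bL) − P(Q, bL) P(τ)` (`Σ_τ c_τ = 0`) and `W_τ = P(τ, oH) Π_{τ' ≠ τ} P(τ')`; the four
sign facts: `c_L ≥ 0` (`bhk_same_cluster_events`), `c_H ≤ 0` (`bhk_cross_cluster`),
`W_L ≤ W_N` (`CovForm.ToL_mul_D_le` with the roots swapped = `bhk_cross_cluster_avoid`), and
`W_H ≥ W_N` — positive association of two events of the OTHER cluster under set avoidance,
**`bhk_other_cluster_avoid`** (new here: explore `C(s)`, Harris in `G − C(s)`, then BHK 1.3 for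
the two decreasing functionals of `C(s)`). The `same` version mirrors the last two facts.
-/

namespace Summit.Ventures.PercRepro2

namespace TypeRB

open CovForm SideBridge

open scoped Classical

variable {V : Type*} {E : Type*} [Fintype E] [DecidableEq E] [Fintype V] [DecidableEq V]
  {R : Type*} [Field R] [LinearOrder R] [IsStrictOrderedRing R]

/-! ## Two events of the other cluster under set avoidance -/

section OtherCluster

variable (p : E → R) (ends : E → Sym2 V)

omit [Fintype E] [DecidableEq E] [Fintype V] [DecidableEq V] in
/-- `{C_t ∈ 𝓥₁ ∩ 𝓥₂} = {C_t ∈ 𝓥₁} ∩ {C_t ∈ 𝓥₂}`. -/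
lemma clusterInEvent_inter (t : V) (𝓥₁ 𝓥₂ : Set (Set V)) :
    clusterInEvent ends t (𝓥₁ ∩ 𝓥₂) = clusterInEvent ends t 𝓥₁ ∩ clusterInEvent ends t 𝓥₂ := by
  ext ω; simp [clusterInEvent]

omit [Fintype E] [DecidableEq E] [Fintype V] [DecidableEq V] [LinearOrder R]
  [IsStrictOrderedRing R] in
/-- `{C_t ∈ 𝓥 in G − W}` is increasing for an up-set `𝓥`. -/
lemma isUpperSet_delCluster (W : Set V) (t : V) {𝓥 : Set (Set V)} (h𝓥 : IsUpperSet 𝓥) :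
    IsUpperSet {ω : Config E | cluster ends (delConfig ends W ω) t ∈ 𝓥} := by
  intro ω ω' hle hω
  have hle' : delConfig ends W ω ≤ delConfig ends W ω' := by
    intro e'
    by_cases he : e' ∈ touches ends W
    · rw [delConfig_apply_of_mem he]; exact Bool.false_le _
    · rw [delConfig_apply_of_notMem he, delConfig_apply_of_notMem he]; exact hle e'
  exact h𝓥 (cluster_mono hle' t) hω

omit [Fintype V] [DecidableEq V] in
/-- Harris in `G − W`: `g_{𝓥₁ ∩ 𝓥₂}(W) ≥ g_{𝓥₁}(W) g_{𝓥₂}(W)`. -/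
lemma delClusterProb_inter_ge (hp : IsProbVec p) (t : V) {𝓥₁ 𝓥₂ : Set (Set V)}
    (h₁ : IsUpperSet 𝓥₁) (h₂ : IsUpperSet 𝓥₂) (W : Set V) :
    delClusterProb p ends t 𝓥₁ W * delClusterProb p ends t 𝓥₂ W ≤
      delClusterProb p ends t (𝓥₁ ∩ 𝓥₂) W := by
  unfold delClusterProb
  have e : {ω : Config E | cluster ends (delConfig ends W ω) t ∈ 𝓥₁ ∩ 𝓥₂} =
      {ω | cluster ends (delConfig ends W ω) t ∈ 𝓥₁} ∩
        {ω | cluster ends (delConfig ends W ω) t ∈ 𝓥₂} := by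
    ext ω; simp
  rw [e]
  exact prob_mul_prob_le_prob_inter hp (isUpperSet_delCluster ends W t h₁)
    (isUpperSet_delCluster ends W t h₂)

/-- **BHK for two events of the other cluster under set avoidance** (`t ∈ X`): for up-sets
`𝓥₁, 𝓥₂`, `P(C_t ∈ 𝓥₁, s↮X) · P(C_t ∈ 𝓥₂, s↮X) ≤ P(C_t ∈ 𝓥₁ ∩ 𝓥₂, s↮X) · P(s↮X)`. -/
theorem bhk_other_cluster_avoid (hp : IsProbVec p) (s t : V) {X : Finset V} (ht : t ∈ X)
    {𝓥₁ 𝓥₂ : Set (Set V)} (h₁ : IsUpperSet 𝓥₁) (h₂ : IsUpperSet 𝓥₂) :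
    prob p (clusterInEvent ends t 𝓥₁ ∩ avoidAll ends s X) *
        prob p (clusterInEvent ends t 𝓥₂ ∩ avoidAll ends s X) ≤
      prob p (clusterInEvent ends t 𝓥₁ ∩ clusterInEvent ends t 𝓥₂ ∩ avoidAll ends s X) *
        prob p (avoidAll ends s X) := by
  set g₁ := delClusterProb p ends t 𝓥₁ with hg₁
  set g₂ := delClusterProb p ends t 𝓥₂ with hg₂
  set g₁₂ := delClusterProb p ends t (𝓥₁ ∩ 𝓥₂) with hg₁₂
  -- the three masses through the exploration of `C_s`
  have e1 := prob_clusterIn_inter_avoid_eq_expect p ends s t ht Set.univ 𝓥₁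
  have e2 := prob_clusterIn_inter_avoid_eq_expect p ends s t ht Set.univ 𝓥₂
  have e12 := prob_clusterIn_inter_avoid_eq_expect p ends s t ht Set.univ (𝓥₁ ∩ 𝓥₂)
  simp only [Set.indicator_univ, Pi.one_apply, one_mul] at e1 e2 e12
  have univ_inter : ∀ 𝓥 : Set (Set V), clusterInEvent ends s Set.univ ∩ clusterInEvent ends t 𝓥 ∩
      avoidAll ends s X = clusterInEvent ends t 𝓥 ∩ avoidAll ends s X := by
    intro 𝓥; ext ω; simp [clusterInEvent]
  rw [univ_inter] at e1 e2 e12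
  rw [clusterInEvent_inter] at e12
  -- Harris in `G − W`, then BHK 1.3 for the decreasing functionals `g₁, g₂` of `C_s`
  have hH : expect p (fun ω => g₁ (cluster ends ω s) * g₂ (cluster ends ω s) *
      (avoidAll ends s X).indicator 1 ω) ≤
      expect p (fun ω => g₁₂ (cluster ends ω s) * (avoidAll ends s X).indicator 1 ω) := by
    refine expect_mono hp fun ω => ?_
    exact mul_le_mul_of_nonneg_right (delClusterProb_inter_ge p ends hp t h₁ h₂ _)
      (Set.indicator_apply_nonneg fun _ => zero_le_one)
  have hg₁_anti : Antitone g₁ := delClusterProb_anti p hp ends t h₁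
  have hg₂_anti : Antitone g₂ := delClusterProb_anti p hp ends t h₂
  have hF₁ : Monotone (fun W => 1 - g₁ W) := fun W W' h => by
    simp only; linarith [hg₁_anti h]
  have hF₂ : Monotone (fun W => 1 - g₂ W) := fun W W' h => by
    simp only; linarith [hg₂_anti h]
  have hF₁0 : ∀ W, 0 ≤ 1 - g₁ W := fun W => by linarith [delClusterProb_le_one p hp ends t 𝓥₁ W]
  have hF₂0 : ∀ W, 0 ≤ 1 - g₂ W := fun W => by linarith [delClusterProb_le_one p hp ends t 𝓥₂ W]
  have key := bhk_induced p hp ends s hF₁ hF₂ hF₁0 hF₂0 Finset.univ X X (Finset.subset_univ _)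
    (Finset.subset_univ _)
  simp only [Finset.inter_self, Finset.union_self, REvent_univ] at key
  have e : ∀ F : Set V → R, clusterObs ends Finset.univ s F * (avoidAll ends s X).indicator 1 =
      fun ω => F (cluster ends ω s) * (avoidAll ends s X).indicator 1 ω := by
    intro F
    funext ω
    simp only [Pi.mul_apply, clusterObs_apply, clusterIn_univ]
  rw [e, e, e] at key
  simp only [Pi.mul_apply] at key
  have eR : prob p (avoidAll ends s X) =
      expect p fun ω => (avoidAll ends s X).indicator 1 ω := prob_eq_expect_indicator p _
  set A := expect p (fun ω => g₁ (cluster ends ω s) * (avoidAll ends s X).indicator 1 ω) with hA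
  set B := expect p (fun ω => g₂ (cluster ends ω s) * (avoidAll ends s X).indicator 1 ω) with hB
  set C := expect p (fun ω => g₁ (cluster ends ω s) * g₂ (cluster ends ω s) *
    (avoidAll ends s X).indicator 1 ω) with hC
  have k1 : expect p (fun ω => (1 - g₁ (cluster ends ω s)) * (avoidAll ends s X).indicator 1 ω) =
      prob p (avoidAll ends s X) - A := by
    rw [eR, hA, ← expect_sub]
    congr 1; funext ω; simp only [Pi.sub_apply]; ring
  have k2 : expect p (fun ω => (1 - g₂ (cluster ends ω s)) * (avoidAll ends s X).indicator 1 ω) =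
      prob p (avoidAll ends s X) - B := by
    rw [eR, hB, ← expect_sub]
    congr 1; funext ω; simp only [Pi.sub_apply]; ring
  have k12 : expect p (fun ω => (1 - g₁ (cluster ends ω s)) * (1 - g₂ (cluster ends ω s)) *
      (avoidAll ends s X).indicator 1 ω) = prob p (avoidAll ends s X) - A - B + C := by
    rw [eR, hA, hB, hC, ← expect_sub, ← expect_sub, ← expect_add]
    congr 1; funext ω; simp only [Pi.sub_apply, Pi.add_apply]; ring
  rw [k1, k2, k12] at key
  -- `A B ≤ C P ≤ E[g₁₂ 1_R] P`
  have hAB : A * B ≤ C * prob p (avoidAll ends s X) := by nlinarith [key]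
  rw [← e1, ← e2] at hAB
  rw [e12]
  have hP0 : 0 ≤ prob p (avoidAll ends s X) := prob_nonneg hp _
  calc prob p (clusterInEvent ends t 𝓥₁ ∩ avoidAll ends s X) *
        prob p (clusterInEvent ends t 𝓥₂ ∩ avoidAll ends s X) ≤
        C * prob p (avoidAll ends s X) := hAB
    _ ≤ expect p (fun ω => g₁₂ (cluster ends ω s) * (avoidAll ends s X).indicator 1 ω) *
        prob p (avoidAll ends s X) := mul_le_mul_of_nonneg_right hH hP0

end OtherCluster

/-! ## The four sign facts in the `(o, a₁, a₂, a₃, b)` vocabulary -/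

section Facts

variable (p : E → R) (ends : E → Sym2 V) (o a₁ a₂ a₃ b : V)

omit [Fintype E] [DecidableEq E] [Fintype V] [DecidableEq V] [LinearOrder R]
  [IsStrictOrderedRing R] in
/-- `L = Q ∩ {a₃ ∈ C(a₁)}`. -/
lemma L_eq : TEvent ends a₂ a₁ a₃ = avoidAll ends a₂ {a₁} ∩ connEvent ends a₁ a₃ := by
  unfold TEvent
  rw [compl_conn_eq_avoidAll]

omit [Fintype E] [DecidableEq E] [Fintype V] [DecidableEq V] [LinearOrder R]
  [IsStrictOrderedRing R] in
/-- `H = Q ∩ {a₃ ∈ C(a₂)}`. -/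
lemma H_eq : TEvent ends a₁ a₂ a₃ = avoidAll ends a₂ {a₁} ∩ connEvent ends a₂ a₃ := by
  unfold TEvent
  rw [compl_conn_eq_avoidAll, avoidAll_root_swap]

/-- **(a)** `c_L ≥ 0`: `P(L) P(Q, bL) ≤ P(L, bL) P(Q)` (BHK same cluster). -/
lemma fact_a (hp : IsProbVec p) :
    prob p (TEvent ends a₂ a₁ a₃) * prob p (avoidAll ends a₂ {a₁} ∩ connEvent ends a₁ b) ≤
      prob p (TEvent ends a₂ a₁ a₃ ∩ connEvent ends a₁ b) * prob p (avoidAll ends a₂ {a₁}) := by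
  have h := bhk_same_cluster_events p hp ends a₁ a₂ (isUpperSet_mem_setOf a₃) (isUpperSet_mem_setOf b)
  rw [← connEvent_eq_clusterInEvent, ← connEvent_eq_clusterInEvent, compl_conn_eq_avoidAll] at h
  rw [L_eq]
  have e1 : connEvent ends a₁ a₃ ∩ avoidAll ends a₂ {a₁} =
      avoidAll ends a₂ {a₁} ∩ connEvent ends a₁ a₃ := Set.inter_comm _ _
  have e2 : connEvent ends a₁ b ∩ avoidAll ends a₂ {a₁} =
      avoidAll ends a₂ {a₁} ∩ connEvent ends a₁ b := Set.inter_comm _ _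
  have e3 : connEvent ends a₁ a₃ ∩ connEvent ends a₁ b ∩ avoidAll ends a₂ {a₁} =
      avoidAll ends a₂ {a₁} ∩ connEvent ends a₁ a₃ ∩ connEvent ends a₁ b := by
    ext ω; simp only [Set.mem_inter_iff]; tauto
  rw [e1, e2, e3] at h
  exact h

/-- **(b)** `c_H ≤ 0`: `P(H, bL) P(Q) ≤ P(H) P(Q, bL)` (BHK different clusters). -/
lemma fact_b (hp : IsProbVec p) :
    prob p (TEvent ends a₁ a₂ a₃ ∩ connEvent ends a₁ b) * prob p (avoidAll ends a₂ {a₁}) ≤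
      prob p (TEvent ends a₁ a₂ a₃) * prob p (avoidAll ends a₂ {a₁} ∩ connEvent ends a₁ b) := by
  have h := bhk_cross_cluster p hp ends a₁ a₂ (isUpperSet_mem_setOf b) (isUpperSet_mem_setOf a₃)
  rw [← connEvent_eq_clusterInEvent, ← connEvent_eq_clusterInEvent, compl_conn_eq_avoidAll] at h
  rw [H_eq]
  have e1 : connEvent ends a₁ b ∩ connEvent ends a₂ a₃ ∩ avoidAll ends a₂ {a₁} =
      avoidAll ends a₂ {a₁} ∩ connEvent ends a₂ a₃ ∩ connEvent ends a₁ b := by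
    ext ω; simp only [Set.mem_inter_iff]; tauto
  have e2 : connEvent ends a₁ b ∩ avoidAll ends a₂ {a₁} =
      avoidAll ends a₂ {a₁} ∩ connEvent ends a₁ b := Set.inter_comm _ _
  have e3 : connEvent ends a₂ a₃ ∩ avoidAll ends a₂ {a₁} =
      avoidAll ends a₂ {a₁} ∩ connEvent ends a₂ a₃ := Set.inter_comm _ _
  rw [e1, e2, e3] at h
  linarith [h]

/-- **(c)** `W_L ≤ W_N`: `P(L, oH) P(N) ≤ P(N, oH) P(L)` (`ToL_mul_D_le` with the roots swapped). -/
lemma fact_c (hp : IsProbVec p) :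
    prob p (TEvent ends a₂ a₁ a₃ ∩ connEvent ends a₂ o) * prob p (PDEvent ends a₁ a₂ a₃) ≤
      prob p (PDEvent ends a₁ a₂ a₃ ∩ connEvent ends a₂ o) * prob p (TEvent ends a₂ a₁ a₃) := by
  have h := ToL_mul_D_le p hp ends o a₂ a₁ a₃
  rwa [PDEvent_root_swap] at h

omit [Fintype E] [DecidableEq E] [Fintype V] [LinearOrder R] [IsStrictOrderedRing R] in
/-- `{o ∈ C₂} ∩ {a₂ ↔ a₃} ∩ R′ = T ∩ {o ∈ C₂}`, `R′ = avoidAll a₁ {a₂, a₃}`. -/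
lemma oH_inter_conn_inter_R :
    connEvent ends a₂ o ∩ connEvent ends a₂ a₃ ∩ avoidAll ends a₁ {a₂, a₃} =
      TEvent ends a₁ a₂ a₃ ∩ connEvent ends a₂ o := by
  rw [Set.inter_assoc, conn_inter_R, Set.inter_comm]

/-- **(d)** `W_H ≥ W_N`: `P(N, oH) P(H) ≤ P(H, oH) P(N)` (`bhk_other_cluster_avoid`). -/
lemma fact_d (hp : IsProbVec p) :
    prob p (PDEvent ends a₁ a₂ a₃ ∩ connEvent ends a₂ o) * prob p (TEvent ends a₁ a₂ a₃) ≤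
      prob p (TEvent ends a₁ a₂ a₃ ∩ connEvent ends a₂ o) * prob p (PDEvent ends a₁ a₂ a₃) := by
  have h := bhk_other_cluster_avoid p ends hp a₁ a₂ (X := {a₂, a₃}) (Finset.mem_insert_self a₂ {a₃})
    (isUpperSet_mem_setOf o) (isUpperSet_mem_setOf a₃)
  rw [← connEvent_eq_clusterInEvent ends a₂ o, ← connEvent_eq_clusterInEvent ends a₂ a₃,
    oH_inter_conn_inter_R, conn_inter_R] at h
  have hR := ISplit.prob_PD_add_T p ends a₁ a₂ a₃ Set.univ
  simp only [Set.inter_univ] at hR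
  have hoR := ISplit.prob_PD_add_T p ends a₁ a₂ a₃ (connEvent ends a₂ o)
  have e : connEvent ends a₂ o ∩ avoidAll ends a₁ {a₂, a₃} =
      avoidAll ends a₁ {a₂, a₃} ∩ connEvent ends a₂ o := Set.inter_comm _ _
  rw [e, ← hoR, ← hR] at h
  nlinarith [h]

/-- **(c′)** `W′_L ≥ W′_N`: `P(N, oL) P(L) ≤ P(L, oL) P(N)` (`bhk_other_cluster_avoid`, roots swapped). -/
lemma fact_c' (hp : IsProbVec p) :
    prob p (PDEvent ends a₁ a₂ a₃ ∩ connEvent ends a₁ o) * prob p (TEvent ends a₂ a₁ a₃) ≤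
      prob p (TEvent ends a₂ a₁ a₃ ∩ connEvent ends a₁ o) * prob p (PDEvent ends a₁ a₂ a₃) := by
  have h := bhk_other_cluster_avoid p ends hp a₂ a₁ (X := {a₁, a₃}) (Finset.mem_insert_self a₁ {a₃})
    (isUpperSet_mem_setOf o) (isUpperSet_mem_setOf a₃)
  rw [← connEvent_eq_clusterInEvent ends a₁ o, ← connEvent_eq_clusterInEvent ends a₁ a₃,
    oH_inter_conn_inter_R ends o a₂ a₁ a₃, conn_inter_R] at h
  have hR := ISplit.prob_PD_add_T p ends a₂ a₁ a₃ Set.univ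
  simp only [Set.inter_univ] at hR
  have hoR := ISplit.prob_PD_add_T p ends a₂ a₁ a₃ (connEvent ends a₁ o)
  have e : connEvent ends a₁ o ∩ avoidAll ends a₂ {a₁, a₃} =
      avoidAll ends a₂ {a₁, a₃} ∩ connEvent ends a₁ o := Set.inter_comm _ _
  rw [e, ← hoR, ← hR, PDEvent_root_swap] at h
  nlinarith [h]

/-- **(d′)** `W′_N ≥ W′_H`: `P(H, oL) P(N) ≤ P(N, oL) P(H)` (`ToL_mul_D_le`). -/
lemma fact_d' (hp : IsProbVec p) :
    prob p (TEvent ends a₁ a₂ a₃ ∩ connEvent ends a₁ o) * prob p (PDEvent ends a₁ a₂ a₃) ≤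
      prob p (PDEvent ends a₁ a₂ a₃ ∩ connEvent ends a₁ o) * prob p (TEvent ends a₁ a₂ a₃) :=
  ToL_mul_D_le p hp ends o a₁ a₂ a₃

end Facts

/-! ## The theorems -/

section Main

variable (p : E → R) (ends : E → Sym2 V) (o a₁ a₂ a₃ b : V)

/-- **THEOREM (TYPE-RB-cross)** (mine-a §19): with `L, H, N` the three sides of `a₃` under `Q`,
`P(Q) Σ_τ P(τ, bL) P(τ, oH) Π_{τ' ≠ τ} P(τ') ≤ P(Q, bL) P(Q, oH) P(L) P(H) P(N)` — i.e.
`Σ_τ μ(τ) μ(bL | τ) μ(oH | τ) ≤ μ(bL) μ(oH)`: `Cov_μ(1_{bL}, μ(oH | σ₃)) ≤ 0`. -/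
theorem typeRB_cross (hp : IsProbVec p) :
    prob p (avoidAll ends a₂ {a₁}) *
        (prob p (TEvent ends a₂ a₁ a₃ ∩ connEvent ends a₁ b) *
            prob p (TEvent ends a₂ a₁ a₃ ∩ connEvent ends a₂ o) *
            (prob p (TEvent ends a₁ a₂ a₃) * prob p (PDEvent ends a₁ a₂ a₃)) +
          prob p (TEvent ends a₁ a₂ a₃ ∩ connEvent ends a₁ b) *
            prob p (TEvent ends a₁ a₂ a₃ ∩ connEvent ends a₂ o) *
            (prob p (TEvent ends a₂ a₁ a₃) * prob p (PDEvent ends a₁ a₂ a₃)) +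
          prob p (PDEvent ends a₁ a₂ a₃ ∩ connEvent ends a₁ b) *
            prob p (PDEvent ends a₁ a₂ a₃ ∩ connEvent ends a₂ o) *
            (prob p (TEvent ends a₂ a₁ a₃) * prob p (TEvent ends a₁ a₂ a₃))) ≤
      prob p (avoidAll ends a₂ {a₁} ∩ connEvent ends a₁ b) *
        prob p (avoidAll ends a₂ {a₁} ∩ connEvent ends a₂ o) *
        (prob p (TEvent ends a₂ a₁ a₃) * prob p (TEvent ends a₁ a₂ a₃) *
          prob p (PDEvent ends a₁ a₂ a₃)) := by
  have hQ := Qsplit_univ p ends a₁ a₂ a₃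
  have hQb := Qsplit p ends a₁ a₂ a₃ (connEvent ends a₁ b)
  have hQo := Qsplit p ends a₁ a₂ a₃ (connEvent ends a₂ o)
  have ha := fact_a p ends a₁ a₂ a₃ b hp
  have hb := fact_b p ends a₁ a₂ a₃ b hp
  have hc := fact_c p ends o a₁ a₂ a₃ hp
  have hd := fact_d p ends o a₁ a₂ a₃ hp
  have hL := prob_nonneg hp (TEvent ends a₂ a₁ a₃)
  have hH := prob_nonneg hp (TEvent ends a₁ a₂ a₃)
  have hN := prob_nonneg hp (PDEvent ends a₁ a₂ a₃)
  -- `(W_L − W_N) c_L ≤ 0` and `(W_H − W_N) c_H ≤ 0`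
  have h1 : 0 ≤ (prob p (TEvent ends a₁ a₂ a₃) *
      (prob p (PDEvent ends a₁ a₂ a₃ ∩ connEvent ends a₂ o) * prob p (TEvent ends a₂ a₁ a₃) -
        prob p (TEvent ends a₂ a₁ a₃ ∩ connEvent ends a₂ o) * prob p (PDEvent ends a₁ a₂ a₃))) *
      (prob p (TEvent ends a₂ a₁ a₃ ∩ connEvent ends a₁ b) * prob p (avoidAll ends a₂ {a₁}) -
        prob p (TEvent ends a₂ a₁ a₃) * prob p (avoidAll ends a₂ {a₁} ∩ connEvent ends a₁ b)) :=
    mul_nonneg (mul_nonneg hH (by linarith [hc])) (by linarith [ha])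
  have h2 : 0 ≤ (prob p (TEvent ends a₂ a₁ a₃) *
      (prob p (TEvent ends a₁ a₂ a₃ ∩ connEvent ends a₂ o) * prob p (PDEvent ends a₁ a₂ a₃) -
        prob p (PDEvent ends a₁ a₂ a₃ ∩ connEvent ends a₂ o) * prob p (TEvent ends a₁ a₂ a₃))) *
      (prob p (TEvent ends a₁ a₂ a₃) * prob p (avoidAll ends a₂ {a₁} ∩ connEvent ends a₁ b) -
        prob p (TEvent ends a₁ a₂ a₃ ∩ connEvent ends a₁ b) * prob p (avoidAll ends a₂ {a₁})) :=
    mul_nonneg (mul_nonneg hL (by linarith [hd])) (by linarith [hb])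
  rw [hQ, hQb, hQo]
  rw [hQ] at h1 h2
  rw [hQb] at h1 h2
  nlinarith [h1, h2]

/-- **THEOREM (TYPE-RB-same)** (mine-a §19): `Σ_τ μ(τ) μ(bL | τ) μ(oL | τ) ≥ μ(bL) μ(oL)`, cleared:
`P(Q) Σ_τ P(τ, bL) P(τ, oL) Π_{τ' ≠ τ} P(τ') ≥ P(Q, bL) P(Q, oL) P(L) P(H) P(N)`. -/
theorem typeRB_same (hp : IsProbVec p) :
    prob p (avoidAll ends a₂ {a₁} ∩ connEvent ends a₁ b) *
        prob p (avoidAll ends a₂ {a₁} ∩ connEvent ends a₁ o) *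
        (prob p (TEvent ends a₂ a₁ a₃) * prob p (TEvent ends a₁ a₂ a₃) *
          prob p (PDEvent ends a₁ a₂ a₃)) ≤
      prob p (avoidAll ends a₂ {a₁}) *
        (prob p (TEvent ends a₂ a₁ a₃ ∩ connEvent ends a₁ b) *
            prob p (TEvent ends a₂ a₁ a₃ ∩ connEvent ends a₁ o) *
            (prob p (TEvent ends a₁ a₂ a₃) * prob p (PDEvent ends a₁ a₂ a₃)) +
          prob p (TEvent ends a₁ a₂ a₃ ∩ connEvent ends a₁ b) *
            prob p (TEvent ends a₁ a₂ a₃ ∩ connEvent ends a₁ o) *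
            (prob p (TEvent ends a₂ a₁ a₃) * prob p (PDEvent ends a₁ a₂ a₃)) +
          prob p (PDEvent ends a₁ a₂ a₃ ∩ connEvent ends a₁ b) *
            prob p (PDEvent ends a₁ a₂ a₃ ∩ connEvent ends a₁ o) *
            (prob p (TEvent ends a₂ a₁ a₃) * prob p (TEvent ends a₁ a₂ a₃))) := by
  have hQ := Qsplit_univ p ends a₁ a₂ a₃
  have hQb := Qsplit p ends a₁ a₂ a₃ (connEvent ends a₁ b)
  have hQo := Qsplit p ends a₁ a₂ a₃ (connEvent ends a₁ o)
  have ha := fact_a p ends a₁ a₂ a₃ b hp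
  have hb := fact_b p ends a₁ a₂ a₃ b hp
  have hc := fact_c' p ends o a₁ a₂ a₃ hp
  have hd := fact_d' p ends o a₁ a₂ a₃ hp
  have hL := prob_nonneg hp (TEvent ends a₂ a₁ a₃)
  have hH := prob_nonneg hp (TEvent ends a₁ a₂ a₃)
  have hN := prob_nonneg hp (PDEvent ends a₁ a₂ a₃)
  -- `(W′_L − W′_N) c_L ≥ 0` and `(W′_H − W′_N) c_H ≥ 0`
  have h1 : 0 ≤ (prob p (TEvent ends a₁ a₂ a₃) *
      (prob p (TEvent ends a₂ a₁ a₃ ∩ connEvent ends a₁ o) * prob p (PDEvent ends a₁ a₂ a₃) -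
        prob p (PDEvent ends a₁ a₂ a₃ ∩ connEvent ends a₁ o) * prob p (TEvent ends a₂ a₁ a₃))) *
      (prob p (TEvent ends a₂ a₁ a₃ ∩ connEvent ends a₁ b) * prob p (avoidAll ends a₂ {a₁}) -
        prob p (TEvent ends a₂ a₁ a₃) * prob p (avoidAll ends a₂ {a₁} ∩ connEvent ends a₁ b)) :=
    mul_nonneg (mul_nonneg hH (by linarith [hc])) (by linarith [ha])
  have h2 : 0 ≤ (prob p (TEvent ends a₂ a₁ a₃) *
      (prob p (PDEvent ends a₁ a₂ a₃ ∩ connEvent ends a₁ o) * prob p (TEvent ends a₁ a₂ a₃) -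
        prob p (TEvent ends a₁ a₂ a₃ ∩ connEvent ends a₁ o) * prob p (PDEvent ends a₁ a₂ a₃))) *
      (prob p (TEvent ends a₁ a₂ a₃) * prob p (avoidAll ends a₂ {a₁} ∩ connEvent ends a₁ b) -
        prob p (TEvent ends a₁ a₂ a₃ ∩ connEvent ends a₁ b) * prob p (avoidAll ends a₂ {a₁})) :=
    mul_nonneg (mul_nonneg hL (by linarith [hd])) (by linarith [hb])
  rw [hQ, hQb, hQo]
  rw [hQ] at h1 h2
  rw [hQb] at h1 h2
  nlinarith [h1, h2]

end Main

end TypeRB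

end Summit.Ventures.PercRepro2

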